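import Summits.ABC.StewartYu.PadicG3VbHalf
import Summits.ABC.StewartYu.PadicG3OneSizes
import HarnessLib

/-!
# Cell abc-stewartyu, crux `Y07Odd` (stmt-ABC-19658), `m = 0` branch: the KUMMER HALF-STEP LINE `half_line_Vb` at `P.schedVb b`

`Summits/ABC/StewartYu/PadicG3VbHalfLine.lean` — cell `abc-stewartyu` (seat p3-g7).  Theorems only, no named fact.  The hH conjunct of
`IneqPackR₃ S (P.schedVb b)` (sharp clearing `DCs`/`MhCs`, p5's (S1)), for every `lev < ŜG`, odd-range `|s₁| ≤ 2·NhS (lev+1) − 1`,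
`|τ| + tS lev ≤ TordS lev n`, under the `m = 0` context and `‖Λ/b_{j₀}‖ ≤ e^{−U}`, `8·2ⁿ·Zp + CondFloorV n ≤ U`:
`log(4·DCs²·(1+UcardS₂·PmaxS₂·MhCs)·heightProd³) ≤ (7/2)·Zp` per degree (`half_threshold_log_le`), far branch from `zerosV lev n ≥ 8·2ⁿ·Zp`,
`Λ`-branch direct (R23) from `AcondV_le`.

References: Yu. V. Nesterenko, LNM 1819 (2003) §4.3 (4.38)–(4.45).
-/

noncomputable section

open Finset Real
open Literature.NumberTheory.Transcendental
open Literature.NumberTheory.Transcendental.PadicCW77 (condExp)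
open Literature.NumberTheory.Transcendental.CW77.Setup (Tau tauNorm)

namespace Summit.ABC.StewartYu

namespace G3Setup

variable {p : ℕ} [Fact p.Prime] (S : G3Setup p) (P : PadicG3Par S.n) (b : ℝ)

/-- `log |b_{j₀}| ≤ W` from `log max(3,|bⱼ|) ≤ W`. [folklore] -/
theorem log_abs_bj₀_le {W : ℝ} (hbW : ∀ j, Real.log (max 3 (|S.b j| : ℝ)) ≤ W) :
    Real.log ((((S.b S.j₀).natAbs : ℕ) : ℝ)) ≤ W := by
  have hb1 : (1 : ℝ) ≤ (((S.b S.j₀).natAbs : ℕ) : ℝ) := by exact_mod_cast Int.natAbs_pos.mpr S.bj₀_ne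
  have e : (((S.b S.j₀).natAbs : ℕ) : ℝ) = |(S.b S.j₀ : ℝ)| := by rw [Nat.cast_natAbs, Int.cast_abs]
  calc Real.log ((((S.b S.j₀).natAbs : ℕ) : ℝ)) ≤ Real.log (max 3 (|S.b S.j₀| : ℝ)) := by
        refine Real.log_le_log (by linarith) ?_
        rw [e]; exact le_max_right _ _
    _ ≤ W := hbW S.j₀

set_option maxHeartbeats 400000 in
/-- **THE HALF-STEP THRESHOLD, PER DEGREE**: `log(4·DCs²·(1 + UcardS₂·PmaxS₂·MhCs)·heightProd³) ≤ (7/2)·Zp` at every admissible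
half-step target of `P.schedVb b` (`m = 0`). [cite: Nesterenko2003, §4.3 (4.39)–(4.44); shape only] -/
theorem half_threshold_log_le (hm : P.m = 0) (hθ : P.θ₀ = 1 / 2) (hNq : P.Nq = P.K) (hK₀ : (P.K₀ : ℝ) = P.p - 1)
    (hn2 : 2 ≤ S.n) (hb : 1 ≤ b) (hA1 : ∀ j, 1 ≤ P.A j) (hαA : ∀ j, Height.logHeight₁ (S.α j) ≤ P.A j)
    (hbW : ∀ j, Real.log (max 3 (|S.b j| : ℝ)) ≤ P.W)
    {lev : ℕ} (hlev : lev < P.SdG) {s₁ : ℤ} (hs : |s₁| ≤ (2 * (S.NhS (P.schedVb b) (lev + 1) : ℤ) - 1 : ℤ))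
    (τ : Tau S.n) (hτ : tauNorm τ + S.tS (P.schedVb b) lev ≤ S.TordS (P.schedVb b) lev S.n) :
    Real.log (4 * (S.DCs (S.Lb (S.sideS₂ (P.schedVb b)) lev) P.HV s₁ τ : ℝ) ^ 2 *
        (1 + (S.UcardS₂ (P.schedVb b) : ℝ) * (S.PmaxS₂ (P.schedVb b)) * S.MhCs (S.Lb (S.sideS₂ (P.schedVb b)) lev) P.L0V P.HV P.SdG lev s₁ τ) *
        CW77.heightProd S.α ^ 3) ≤ (7 / 2) * P.Zp := by
  have hn1 : 1 ≤ S.n := by omega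
  have hcost := P.half_cost_le hm hθ hNq hK₀ hn2
  -- positivity of the factors
  have hD1 : (1 : ℝ) ≤ (S.DCs (S.Lb (S.sideS₂ (P.schedVb b)) lev) P.HV s₁ τ : ℝ) := by exact_mod_cast S.one_le_DCs _ _ _ _
  have hQ0 := S.MhCs_nonneg (S.Lb (S.sideS₂ (P.schedVb b)) lev) P.L0V P.HV P.SdG lev s₁ τ
  have hU1 : (1 : ℝ) ≤ (S.UcardS₂ (P.schedVb b) : ℝ) := by exact_mod_cast S.one_le_UcardS₂ (P.schedVb b)
  obtain ⟨hP1, _⟩ := S.PmaxS₂_le_two_mul (P.schedVb b)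
  have hHp1 := CW77.one_le_heightProd S.α
  -- (i) `log DCs`
  have hν := NWPi.log_lcmUpto_le P.HV
  have hν1 : (1 : ℝ) ≤ (Nat.lcmUpto P.HV : ℝ) := by exact_mod_cast Nat.lcmUpto_pos P.HV
  have hb1 : (1 : ℝ) ≤ (((S.b S.j₀).natAbs : ℕ) : ℝ) := by exact_mod_cast Int.natAbs_pos.mpr S.bj₀_ne
  have hbW' := S.log_abs_bj₀_le hbW
  have hd1 : (1 : ℝ) ≤ (S.halfDen (S.Lb (S.sideS₂ (P.schedVb b)) lev) s₁ : ℝ) := by exact_mod_cast S.one_le_halfDen _ _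
  have hlogD : Real.log (S.DCs (S.Lb (S.sideS₂ (P.schedVb b)) lev) P.HV s₁ τ : ℝ) ≤
      τ.1 * (23 / 20 * P.HV) + P.W * ((∑ k, τ.2 k : ℕ) : ℝ) + Real.log (S.halfDen (S.Lb (S.sideS₂ (P.schedVb b)) lev) s₁ : ℝ) := by
    unfold DCs
    push_cast
    rw [Real.log_mul (by positivity) (by linarith), Real.log_mul (by positivity) (by positivity), Real.log_pow, Real.log_pow]
    have ht1 : (0 : ℝ) ≤ τ.1 := Nat.cast_nonneg _
    have ht2 : (0 : ℝ) ≤ ((∑ k, τ.2 k : ℕ) : ℝ) := Nat.cast_nonneg _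
    push_cast at ht2 ⊢
    nlinarith [mul_le_mul_of_nonneg_left hν ht1, mul_le_mul_of_nonneg_left hbW' ht2]
  -- (ii) `log (1 + Q)`
  have hlunk0 : 0 ≤ P.lunkV := P.piecesV_nonneg.2.2.2
  have hUexp : (S.UcardS₂ (P.schedVb b) : ℝ) ≤ Real.exp P.lunkV := by
    rw [← Real.exp_log (by linarith : (0 : ℝ) < S.UcardS₂ (P.schedVb b))]
    exact Real.exp_le_exp.mpr (S.log_UcardS₂_Vb_le P b hb)
  have hPexp : (S.PmaxS₂ (P.schedVb b) : ℝ) ≤ Real.exp (Real.log 2 + P.lunkV + (Real.log 2 +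
      (69 / 4) * (S.n + 1) * P.LgV * (P.SdG * Real.log 2 + 43 / 20 * P.HV + 2 * Real.log S.n) + P.HV / Real.exp 1 +
      P.L0V * ((P.SdG + S.n + 6) * Real.log 2) + 2 * P.htsV 0)) := by
    rw [← Real.exp_log (by linarith : (0 : ℝ) < S.PmaxS₂ (P.schedVb b))]
    exact Real.exp_le_exp.mpr (S.log_PmaxS₂_Vb_le P b hb hn1 hA1 hαA hbW)
  have hs' : (|s₁| : ℝ) ≤ 2 ^ ((lev + 1) + S.n) * (9 * P.HV) := by
    have h1 : ((|s₁| : ℤ) : ℝ) ≤ ((2 * (S.NhS (P.schedVb b) (lev + 1) : ℤ) - 1 : ℤ) : ℝ) := by exact_mod_cast hs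
    have h2 := S.halfNodes_Vb_le_HV P b hn1 lev
    push_cast at h1 h2 ⊢
    linarith only [h1, h2]
  have hMexp := S.M0C_Vb_le_exp P (by omega : lev + 1 ≤ P.SdG) hs' τ.1
  have hXexp := S.XbC_pow_Vb_le P b hb hn1 hA1 hbW lev (∑ k, τ.2 k)
  have hH1 := S.one_le_halfHgtR (S.Lb (S.sideS₂ (P.schedVb b)) lev) s₁
  -- signs of the exponents
  have hl2 : 0 ≤ Real.log 2 := Real.log_nonneg (by norm_num)
  have hlogn : (0 : ℝ) ≤ Real.log S.n := Real.log_nonneg (by exact_mod_cast hn1)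
  have hHV : (0 : ℝ) ≤ P.HV := by positivity
  have hL0 : (0 : ℝ) ≤ P.L0V := by positivity
  have hLgV : (0 : ℝ) ≤ P.LgV := by positivity
  have hhts0 := P.htsV_nonneg 0
  have hW0 : 0 ≤ P.W := le_trans zero_le_one P.hW
  have hLV1 := P.one_le_LV
  have hXB0 : 0 ≤ Real.log 2 + 2 * Real.log S.n + P.W + Real.log P.LV := by
    have := Real.log_nonneg hLV1; positivity
  -- `Q ≤ Q'`, `Q' ≥ 1`
  have hM0 := (M0C_pos P.L0V P.HV P.SdG (lev + 1) s₁ τ.1).le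
  have hX0 : (0 : ℝ) ≤ (S.XbC (S.Lb (S.sideS₂ (P.schedVb b)) lev) : ℝ) ^ (∑ k, τ.2 k) := pow_nonneg (S.XbC_nonneg _) _
  have hMh : S.MhCs (S.Lb (S.sideS₂ (P.schedVb b)) lev) P.L0V P.HV P.SdG lev s₁ τ ≤
      (2 : ℝ) ^ τ.1 * Real.exp (Real.log 2 + τ.1 * (P.SdG * Real.log 2 + 23 / 20 * P.HV) + P.HV / Real.exp 1 + P.L0V * ((P.SdG + S.n + 6) * Real.log 2)) *
        Real.exp (((∑ k, τ.2 k : ℕ) : ℝ) * (Real.log 2 + 2 * Real.log S.n + P.W + Real.log P.LV)) * S.halfHgtR (S.Lb (S.sideS₂ (P.schedVb b)) lev) s₁ := by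
    unfold MhCs
    gcongr
  set Q' : ℝ := Real.exp P.lunkV * Real.exp (Real.log 2 + P.lunkV + (Real.log 2 +
      (69 / 4) * (S.n + 1) * P.LgV * (P.SdG * Real.log 2 + 43 / 20 * P.HV + 2 * Real.log S.n) + P.HV / Real.exp 1 +
      P.L0V * ((P.SdG + S.n + 6) * Real.log 2) + 2 * P.htsV 0)) *
      ((2 : ℝ) ^ τ.1 * Real.exp (Real.log 2 + τ.1 * (P.SdG * Real.log 2 + 23 / 20 * P.HV) + P.HV / Real.exp 1 + P.L0V * ((P.SdG + S.n + 6) * Real.log 2)) *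
        Real.exp (((∑ k, τ.2 k : ℕ) : ℝ) * (Real.log 2 + 2 * Real.log S.n + P.W + Real.log P.LV)) * S.halfHgtR (S.Lb (S.sideS₂ (P.schedVb b)) lev) s₁) with hQ'
  have hQle : (S.UcardS₂ (P.schedVb b) : ℝ) * (S.PmaxS₂ (P.schedVb b)) * S.MhCs (S.Lb (S.sideS₂ (P.schedVb b)) lev) P.L0V P.HV P.SdG lev s₁ τ ≤ Q' := by
    rw [hQ']
    have hP0 : (0 : ℝ) ≤ (S.PmaxS₂ (P.schedVb b) : ℝ) := le_trans zero_le_one hP1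
    exact mul_le_mul (mul_le_mul hUexp hPexp hP0 (by positivity)) hMh hQ0 (by positivity)
  have hQ'1 : 1 ≤ Q' := by
    rw [hQ']
    have e1 : (1 : ℝ) ≤ Real.exp P.lunkV := Real.one_le_exp hlunk0
    have e2 : (1 : ℝ) ≤ Real.exp (Real.log 2 + P.lunkV + (Real.log 2 +
      (69 / 4) * (S.n + 1) * P.LgV * (P.SdG * Real.log 2 + 43 / 20 * P.HV + 2 * Real.log S.n) + P.HV / Real.exp 1 +
      P.L0V * ((P.SdG + S.n + 6) * Real.log 2) + 2 * P.htsV 0)) := Real.one_le_exp (by positivity)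
    have e3 : (1 : ℝ) ≤ (2 : ℝ) ^ τ.1 := one_le_pow₀ (by norm_num)
    have e4 : (1 : ℝ) ≤ Real.exp (Real.log 2 + τ.1 * (P.SdG * Real.log 2 + 23 / 20 * P.HV) + P.HV / Real.exp 1 + P.L0V * ((P.SdG + S.n + 6) * Real.log 2)) :=
      Real.one_le_exp (by positivity)
    have e5 : (1 : ℝ) ≤ Real.exp (((∑ k, τ.2 k : ℕ) : ℝ) * (Real.log 2 + 2 * Real.log S.n + P.W + Real.log P.LV)) := Real.one_le_exp (by positivity)
    calc (1 : ℝ) = 1 * 1 * (1 * 1 * 1 * 1) := by ring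
      _ ≤ _ := by gcongr
  have hlogQ : Real.log (1 + (S.UcardS₂ (P.schedVb b) : ℝ) * (S.PmaxS₂ (P.schedVb b)) * S.MhCs (S.Lb (S.sideS₂ (P.schedVb b)) lev) P.L0V P.HV P.SdG lev s₁ τ) ≤
      Real.log 2 + Real.log Q' := by
    rw [← Real.log_mul (by norm_num) (by linarith only [hQ'1])]
    refine Real.log_le_log ?_ (by linarith only [hQle, hQ'1])
    have : (0 : ℝ) ≤ (S.UcardS₂ (P.schedVb b) : ℝ) * (S.PmaxS₂ (P.schedVb b)) * S.MhCs (S.Lb (S.sideS₂ (P.schedVb b)) lev) P.L0V P.HV P.SdG lev s₁ τ := by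
      have hP0 : (0 : ℝ) ≤ (S.PmaxS₂ (P.schedVb b) : ℝ) := le_trans zero_le_one hP1
      positivity
    linarith only [this]
  have hlogQ' : Real.log Q' = P.lunkV + (Real.log 2 + P.lunkV + (Real.log 2 +
      (69 / 4) * (S.n + 1) * P.LgV * (P.SdG * Real.log 2 + 43 / 20 * P.HV + 2 * Real.log S.n) + P.HV / Real.exp 1 +
      P.L0V * ((P.SdG + S.n + 6) * Real.log 2) + 2 * P.htsV 0)) +
      (τ.1 * Real.log 2 + (Real.log 2 + τ.1 * (P.SdG * Real.log 2 + 23 / 20 * P.HV) + P.HV / Real.exp 1 + P.L0V * ((P.SdG + S.n + 6) * Real.log 2)) +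
        ((∑ k, τ.2 k : ℕ) : ℝ) * (Real.log 2 + 2 * Real.log S.n + P.W + Real.log P.LV) +
        Real.log (S.halfHgtR (S.Lb (S.sideS₂ (P.schedVb b)) lev) s₁)) := by
    rw [hQ', Real.log_mul (by positivity) (by positivity), Real.log_mul (by positivity) (by positivity),
      Real.log_mul (by positivity) (by positivity), Real.log_mul (by positivity) (by positivity), Real.log_mul (by positivity) (by positivity),
      Real.log_exp, Real.log_exp, Real.log_exp, Real.log_exp, Real.log_pow]
  -- (iii) heights and the joint half-point charge
  have hHp := S.log_heightProd_le P hαA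
  have hjoint := S.two_mul_log_halfDen_add_le (S.Lb (S.sideS₂ (P.schedVb b)) lev) s₁
  rw [S.sum_halfE_mul_eq] at hjoint
  have hhalf := S.half_height_Vb_le P b hb hαA lev hs
  -- (iv) the order budget of the target
  have hτr : ((τ.1 : ℝ) + ((∑ k, τ.2 k : ℕ) : ℝ)) ≤ (17 * S.n + 21) / 2 * P.LgV := by
    have h1 : tauNorm τ ≤ S.TordS (P.schedVb b) lev S.n - S.tS (P.schedVb b) lev := by omega
    have h2 : ((tauNorm τ : ℕ) : ℝ) ≤ ((S.TordS (P.schedVb b) lev S.n - S.tS (P.schedVb b) lev : ℕ) : ℝ) := by exact_mod_cast h1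
    unfold tauNorm at h2; rw [Nat.cast_add] at h2
    exact h2.trans (S.TordS_Vb_half_sub_real_le P b lev)
  have hWHV : P.W ≤ P.HV := by
    have h1 := P.W_log_LV_le_HV; have h2 := Real.log_nonneg hLV1; linarith only [h1, h2, hl2]
  have ht1 : (0 : ℝ) ≤ τ.1 := Nat.cast_nonneg _
  have ht2 : (0 : ℝ) ≤ ((∑ k, τ.2 k : ℕ) : ℝ) := Nat.cast_nonneg _
  have hSd : (0 : ℝ) ≤ P.SdG * Real.log 2 := by positivity
  have hτsum : (τ.1 : ℝ) * (P.SdG * Real.log 2 + Real.log 2 + 69 / 20 * P.HV) +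
      ((∑ k, τ.2 k : ℕ) : ℝ) * (2 * P.W + (Real.log 2 + 2 * Real.log S.n + P.W + Real.log P.LV)) ≤
      (17 * S.n + 21) / 2 * P.LgV * (P.SdG * Real.log 2 + Real.log 2 + 69 / 20 * P.HV + 2 * Real.log S.n) := by
    have hW := P.W_log_LV_le_HV
    have hc0 : (0 : ℝ) ≤ P.SdG * Real.log 2 + Real.log 2 + 69 / 20 * P.HV + 2 * Real.log S.n := by positivity
    calc (τ.1 : ℝ) * (P.SdG * Real.log 2 + Real.log 2 + 69 / 20 * P.HV) +
        ((∑ k, τ.2 k : ℕ) : ℝ) * (2 * P.W + (Real.log 2 + 2 * Real.log S.n + P.W + Real.log P.LV))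
        ≤ τ.1 * (P.SdG * Real.log 2 + Real.log 2 + 69 / 20 * P.HV + 2 * Real.log S.n) +
          ((∑ k, τ.2 k : ℕ) : ℝ) * (P.SdG * Real.log 2 + Real.log 2 + 69 / 20 * P.HV + 2 * Real.log S.n) :=
          add_le_add (mul_le_mul_of_nonneg_left (by linarith only [hlogn]) ht1)
            (mul_le_mul_of_nonneg_left (by linarith only [hW, hWHV, hSd, hl2]) ht2)
      _ = ((τ.1 : ℝ) + ((∑ k, τ.2 k : ℕ) : ℝ)) * (P.SdG * Real.log 2 + Real.log 2 + 69 / 20 * P.HV + 2 * Real.log S.n) := by ring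
      _ ≤ _ := mul_le_mul_of_nonneg_right hτr hc0
  -- (v) assemble `log M`
  have hMprod : Real.log (4 * (S.DCs (S.Lb (S.sideS₂ (P.schedVb b)) lev) P.HV s₁ τ : ℝ) ^ 2 *
        (1 + (S.UcardS₂ (P.schedVb b) : ℝ) * (S.PmaxS₂ (P.schedVb b)) * S.MhCs (S.Lb (S.sideS₂ (P.schedVb b)) lev) P.L0V P.HV P.SdG lev s₁ τ) *
        CW77.heightProd S.α ^ 3) =
      Real.log 4 + 2 * Real.log (S.DCs (S.Lb (S.sideS₂ (P.schedVb b)) lev) P.HV s₁ τ : ℝ) +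
        Real.log (1 + (S.UcardS₂ (P.schedVb b) : ℝ) * (S.PmaxS₂ (P.schedVb b)) * S.MhCs (S.Lb (S.sideS₂ (P.schedVb b)) lev) P.L0V P.HV P.SdG lev s₁ τ) +
        3 * Real.log (CW77.heightProd S.α) := by
    have hQpos : 0 < 1 + (S.UcardS₂ (P.schedVb b) : ℝ) * (S.PmaxS₂ (P.schedVb b)) * S.MhCs (S.Lb (S.sideS₂ (P.schedVb b)) lev) P.L0V P.HV P.SdG lev s₁ τ := by
      have hP0 : (0 : ℝ) ≤ (S.PmaxS₂ (P.schedVb b) : ℝ) := le_trans zero_le_one hP1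
      positivity
    rw [Real.log_mul (by positivity) (by positivity), Real.log_mul (by positivity) hQpos.ne',
      Real.log_mul (by norm_num) (by positivity), Real.log_pow, Real.log_pow]
    push_cast; ring
  rw [hMprod]
  have hl4 : Real.log 4 = 2 * Real.log 2 := by
    rw [show (4 : ℝ) = 2 ^ 2 by norm_num, Real.log_pow]; norm_num
  rw [hl4] at hcost ⊢
  rw [hlogQ'] at hlogQ
  linarith only [hlogD, hlogQ, hHp, hjoint, hhalf, hτsum, hcost]

set_option maxHeartbeats 400000 in
/-- **THE HALF-STEP LINE at `P.schedVb b`** (the hH family of the pack): far branch from `zerosV lev n ≥ 8·2ⁿ·Zp`, `Λ`-branch direct.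
[cite: Nesterenko2003, §4.3 (4.38)–(4.45); shape only] -/
theorem half_line_Vb (hp : P.p = p) (hm : P.m = 0) (hθ : P.θ₀ = 1 / 2) (hNq : P.Nq = P.K) (hK₀ : (P.K₀ : ℝ) = P.p - 1)
    (hn2 : 2 ≤ S.n) (hb : 1 ≤ b) (hA1 : ∀ j, 1 ≤ P.A j) (hαA : ∀ j, Height.logHeight₁ (S.α j) ≤ P.A j)
    (hbW : ∀ j, Real.log (max 3 (|S.b j| : ℝ)) ≤ P.W)
    {U : ℝ} (hΛU : ‖S.Λ / (S.b S.j₀ : ℚ_[p])‖ ≤ Real.exp (-U)) (hU : 8 * 2 ^ S.n * P.Zp + P.CondFloorV S.n ≤ U)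
    {lev : ℕ} (hlev : lev < P.SdG) {s₁ : ℤ} (hs : |s₁| ≤ (2 * (S.NhS (P.schedVb b) (lev + 1) : ℤ) - 1 : ℤ))
    (τ : Tau S.n) (hτ : tauNorm τ + S.tS (P.schedVb b) lev ≤ S.TordS (P.schedVb b) lev S.n) :
    max (BwP (p := p) P.L0V P.m * ‖S.Λ / (S.b S.j₀ : ℚ_[p])‖ * (p : ℝ) ^ ((S.tS (P.schedVb b) lev - 1) / 2) *
          (p : ℝ) ^ condExp p (2 * S.NS (P.schedVb b) lev S.n + 1) (S.tS (P.schedVb b) lev))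
        (BwP (p := p) P.L0V P.m / ((p : ℝ) ^ P.m * Real.sqrt p) ^ ((2 * S.NS (P.schedVb b) lev S.n + 1) * S.tS (P.schedVb b) lev)) <
      (S.DCs (S.Lb (S.sideS₂ (P.schedVb b)) lev) P.HV s₁ τ : ℝ) /
        (4 * (S.DCs (S.Lb (S.sideS₂ (P.schedVb b)) lev) P.HV s₁ τ : ℝ) ^ 2 *
          (1 + (S.UcardS₂ (P.schedVb b) : ℝ) * (S.PmaxS₂ (P.schedVb b)) * S.MhCs (S.Lb (S.sideS₂ (P.schedVb b)) lev) P.L0V P.HV P.SdG lev s₁ τ) *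
          CW77.heightProd S.α ^ 3) ^ (2 ^ (S.n + 1)) := by
  have hprime : p.Prime := Fact.out
  have hp2 : 2 ≤ p := hprime.two_le
  have hpR : (2 : ℝ) ≤ p := by exact_mod_cast hp2
  have hNqK : P.Nq ≤ 2 ^ S.n * P.K := by rw [hNq]; exact Nat.le_mul_of_pos_left _ (by positivity)
  have hθ' : 1 / 2 ≤ P.θ₀ := by rw [hθ]
  -- the threshold
  set D : ℝ := (S.DCs (S.Lb (S.sideS₂ (P.schedVb b)) lev) P.HV s₁ τ : ℝ) with hD
  set M : ℝ := 4 * D ^ 2 * (1 + (S.UcardS₂ (P.schedVb b) : ℝ) * (S.PmaxS₂ (P.schedVb b)) *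
      S.MhCs (S.Lb (S.sideS₂ (P.schedVb b)) lev) P.L0V P.HV P.SdG lev s₁ τ) * CW77.heightProd S.α ^ 3 with hM
  have hD1 : 1 ≤ D := by rw [hD]; exact_mod_cast S.one_le_DCs _ _ _ _
  obtain ⟨hP1, _⟩ := S.PmaxS₂_le_two_mul (P.schedVb b)
  have hQ0 : (0 : ℝ) ≤ (S.UcardS₂ (P.schedVb b) : ℝ) * (S.PmaxS₂ (P.schedVb b)) * S.MhCs (S.Lb (S.sideS₂ (P.schedVb b)) lev) P.L0V P.HV P.SdG lev s₁ τ := by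
    have hP0 : (0 : ℝ) ≤ (S.PmaxS₂ (P.schedVb b) : ℝ) := le_trans zero_le_one hP1
    have := S.MhCs_nonneg (S.Lb (S.sideS₂ (P.schedVb b)) lev) P.L0V P.HV P.SdG lev s₁ τ
    positivity
  have hHp1 := CW77.one_le_heightProd S.α
  have hMpos : 0 < M := by rw [hM]; positivity
  have hMlog := S.half_threshold_log_le P b hm hθ hNq hK₀ hn2 hb hA1 hαA hbW hlev hs τ hτ
  rw [← hD, ← hM] at hMlog
  have hMexp : M ^ (2 ^ (S.n + 1)) ≤ Real.exp (2 ^ (S.n + 1) * ((7 / 2) * P.Zp)) := by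
    have h1 : M ≤ Real.exp ((7 / 2) * P.Zp) := by rw [← Real.exp_log hMpos]; exact Real.exp_le_exp.mpr hMlog
    calc M ^ (2 ^ (S.n + 1)) ≤ (Real.exp ((7 / 2) * P.Zp)) ^ (2 ^ (S.n + 1)) := pow_le_pow_left₀ hMpos.le h1 _
      _ = Real.exp (2 ^ (S.n + 1) * ((7 / 2) * P.Zp)) := by rw [← Real.exp_nat_mul]; push_cast; ring_nf
  -- the coefficient bound and the cost atoms
  have hBwpos : 0 < BwP (p := p) P.L0V P.m := by unfold BwP; positivity
  have hBwexp : BwP (p := p) P.L0V P.m ≤ Real.exp (P.L0V * (P.G + 1)) := by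
    have h := P.log_BwP_shape_le hθ
    rw [hp] at h
    rw [← Real.exp_log hBwpos]
    exact Real.exp_le_exp.mpr h
  have hL0G := P.L0V_G_le hm hθ hNq hK₀
  have hZ := P.Zp_facts.1
  have hZ36 := P.Zp_ge
  obtain ⟨hGZ, _, _, _, _⟩ := P.tinyV
  have hzeros := P.zerosV_ge' lev S.n
  have h2n : (4 : ℝ) ≤ 2 ^ S.n := by
    calc (4 : ℝ) = 2 ^ 2 := by norm_num
      _ ≤ 2 ^ S.n := pow_le_pow_right₀ (by norm_num) hn2
  have h2n1 : (2 : ℝ) ^ (S.n + 1) = 2 * 2 ^ S.n := by rw [pow_succ]; ring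
  -- reduce both branches to `term · M^e < 1 ≤ D`
  have hgoal : ∀ a : ℝ, 0 ≤ a → a * M ^ (2 ^ (S.n + 1)) < 1 → a < D / M ^ (2 ^ (S.n + 1)) := by
    intro a _ h
    rw [lt_div_iff₀ (pow_pos hMpos _)]
    linarith
  refine max_lt (hgoal _ (by positivity) ?_) (hgoal _ (by positivity) ?_)
  · -- Λ BRANCH
    have hlogp : 0 ≤ Real.log (p : ℝ) := Real.log_nonneg (by linarith)
    have ht : (S.tS (P.schedVb b) lev - 1) / 2 ≤ 4 * P.LgV := by
      rw [S.tS_Vb P b]; have := P.TV_le lev; omega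
    have hpow1 : (p : ℝ) ^ ((S.tS (P.schedVb b) lev - 1) / 2) ≤ Real.exp (4 * P.LgV * Real.log P.p) := by
      rw [hp, ← Real.rpow_natCast, Real.rpow_def_of_pos (by linarith)]
      refine Real.exp_le_exp.mpr ?_
      have : (((S.tS (P.schedVb b) lev - 1) / 2 : ℕ) : ℝ) ≤ 4 * P.LgV := by exact_mod_cast ht
      nlinarith
    have hcond := PadicCW77.condExp_mul_log_le hp2 (2 * S.NS (P.schedVb b) lev S.n + 1) (S.tS (P.schedVb b) lev)
    obtain ⟨_, hκ0⟩ := P.kappa_le_one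
    rw [hp] at hκ0
    have htS : ((S.tS (P.schedVb b) lev : ℕ) : ℝ) = P.TV lev + 1 := by rw [S.tS_Vb P b]; push_cast; ring
    have hkR : (((2 * S.NS (P.schedVb b) lev S.n + 1 : ℕ)) : ℝ) = 2 ^ (S.n + 1) * P.XsV lev + 1 := by
      rw [S.NS_Vb P b]; push_cast; rw [pow_succ]; ring
    have hpow2 : (p : ℝ) ^ condExp p (2 * S.NS (P.schedVb b) lev S.n + 1) (S.tS (P.schedVb b) lev) ≤
        Real.exp (P.AcondV lev S.n - 4 * P.LgV * Real.log P.p) := by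
      have hAdef : P.AcondV lev S.n - 4 * P.LgV * Real.log P.p =
          (2 ^ (S.n + 1) * P.XsV lev + 1) * (P.TV lev + 1) * (Real.log p / (p - 1)) +
            (P.TV lev + 1) * Real.log (2 * (2 ^ (S.n + 1) * P.XsV lev + 1)) := by
        unfold PadicG3Par.AcondV; rw [hp]; ring
      rw [← Real.rpow_natCast, Real.rpow_def_of_pos (by linarith), hAdef]
      refine Real.exp_le_exp.mpr ?_
      rw [htS, hkR] at hcond
      rw [mul_comm]
      linarith only [hcond]
    have hAc := P.AcondV_le hθ' hlev.le (le_refl S.n)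
    have hnorm0 : 0 ≤ ‖S.Λ / (S.b S.j₀ : ℚ_[p])‖ := norm_nonneg _
    calc BwP (p := p) P.L0V P.m * ‖S.Λ / (S.b S.j₀ : ℚ_[p])‖ * (p : ℝ) ^ ((S.tS (P.schedVb b) lev - 1) / 2) *
          (p : ℝ) ^ condExp p (2 * S.NS (P.schedVb b) lev S.n + 1) (S.tS (P.schedVb b) lev) * M ^ (2 ^ (S.n + 1))
        ≤ Real.exp (P.L0V * (P.G + 1)) * Real.exp (-U) * Real.exp (4 * P.LgV * Real.log P.p) *
          Real.exp (P.AcondV lev S.n - 4 * P.LgV * Real.log P.p) * Real.exp (2 ^ (S.n + 1) * ((7 / 2) * P.Zp)) := by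
          gcongr
      _ < 1 := by
          rw [← Real.exp_add, ← Real.exp_add, ← Real.exp_add, ← Real.exp_add, Real.exp_lt_one_iff]
          rw [h2n1]
          have hprod : 4 * P.Zp ≤ 2 ^ S.n * P.Zp := mul_le_mul_of_nonneg_right h2n hZ.le
          have h36 : (2 : ℝ) ^ 36 = 68719476736 := by norm_num
          have h32 : (2 : ℝ) ^ 32 = 4294967296 := by norm_num
          rw [h36] at hZ36; rw [h32] at hGZ
          linarith only [hL0G, hU, hAc, hGZ, hZ36, hprod, hZ]
  · -- FAR BRANCH
    have hrho : ((p : ℝ) ^ P.m * Real.sqrt p) ^ ((2 * S.NS (P.schedVb b) lev S.n + 1) * S.tS (P.schedVb b) lev) =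
        Real.exp (P.G * (((2 * S.NS (P.schedVb b) lev S.n + 1) * S.tS (P.schedVb b) lev : ℕ) : ℝ)) := by
      have h := P.rho_pow_eq_exp hθ ((2 * S.NS (P.schedVb b) lev S.n + 1) * S.tS (P.schedVb b) lev); rw [hp] at h; exact h
    have hE : P.zerosV lev S.n ≤ P.G * (((2 * S.NS (P.schedVb b) lev S.n + 1) * S.tS (P.schedVb b) lev : ℕ) : ℝ) := by
      have h := P.zerosV_le_gain lev S.n
      rw [S.NS_Vb P b, S.tS_Vb P b]
      exact h
    rw [hrho, div_mul_eq_mul_div, div_lt_iff₀ (Real.exp_pos _), one_mul]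
    calc BwP (p := p) P.L0V P.m * M ^ (2 ^ (S.n + 1)) ≤ Real.exp (P.L0V * (P.G + 1)) * Real.exp (2 ^ (S.n + 1) * ((7 / 2) * P.Zp)) :=
          mul_le_mul hBwexp hMexp (pow_pos hMpos _).le (Real.exp_pos _).le
      _ < Real.exp (P.G * (((2 * S.NS (P.schedVb b) lev S.n + 1) * S.tS (P.schedVb b) lev : ℕ) : ℝ)) := by
          rw [← Real.exp_add]
          refine Real.exp_lt_exp.mpr ?_
          rw [h2n1]
          have hzeros' : 8 * 2 ^ S.n * P.Zp ≤ P.zerosV lev S.n := hzeros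
          have hprod : 4 * P.Zp ≤ 2 ^ S.n * P.Zp := mul_le_mul_of_nonneg_right h2n hZ.le
          have h36 : (2 : ℝ) ^ 36 = 68719476736 := by norm_num
          have h32 : (2 : ℝ) ^ 32 = 4294967296 := by norm_num
          rw [h36] at hZ36; rw [h32] at hGZ
          linarith only [hL0G, hzeros', hE, hGZ, hZ36, hprod, hZ]

end G3Setup

end Summit.ABC.StewartYu

end
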